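import Summits.ValiantsHypothesis.ValiantsHypothesis.Theorems.BarrierLeverPartitionMinorsHitByVPCorankRepair

/-!
# Route BarrierLever — Chow witnesses for partition minors (items 20172 / 20195): the GENERIC
# product of affine forms, and ONE witness for finitely many layouts

Helper file (`--supports stmt-ValiantsHypothesis-20195`; cell valiant-natproofs, rung V4, 𝒟-side of
door (c); seat val-np-p4 gen 10).  Closes NO item; imports only the Mathlib/Literature-level
`…PartitionMinorsHitByVPCorankRepair`.

Items 20172 `ChowHitsPartitionMinors` / 20195 `ChowHitsThinRowPartitionMinors` ask, for each layout
`(u, w)`, for a product `∏_k ℓ_k` of `h + h` affine forms (`(ℓ k).totalDegree ≤ 1`) in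
`MvPolynomial (Fin (h+h)) ℂ` whose partition minor `det[coeff_{E (u i) (w j)} ∏ ℓ]` is nonzero.  Every
argument «for GENERIC forms …» (planner valiant-natproofs-p1 g14's MEMO-thinrows §1c, §2) rests on the
polynomial method made explicit here:

* the GENERIC PRODUCT `∏_k (C c_{k,∅} + Σ_v C c_{k,v} · X v)` with INDETERMINATE coefficients
  `c_{k,o} = X (k, o)`, `o : Option (Fin (h+h))`, a polynomial over the coefficient ring
  `MvPolynomial (Fin (h+h) × Option (Fin (h+h))) ℂ`; specialising the coefficients (`map (eval θ)`)
  gives every concrete product of affine forms (`map_eval_genericChow`, with `eq_affine_of_totalDegree_le_one`: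
  a polynomial of total degree `≤ 1` IS `C (coeff 0) + Σ_v C (coeff e_v) X v`);
* the partition minor of the generic product is a POLYNOMIAL IN THE COEFFICIENTS whose evaluations are
  the partition minors of the concrete products (`eval_det_coeff_genericChow`);
* hence a layout is hit iff that polynomial is nonzero (`genericChow_det_ne_zero_of_hit`), and
  **finitely many layouts that are each hit by some product are hit by ONE product**
  (`exists_common_chow_witness`; `ℂ` is infinite, `MvPolynomial.funext`).

WHAT THIS IS NOT: the polynomial method, no new hit layout; nothing on items 20195 / 20172 / 19717
themselves, on crux stmt-ValiantsHypothesis-14610, or on `VP` versus `VNP`.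
-/

set_option linter.dupNamespace false

namespace Summit.ValiantsHypothesis.ValiantsHypothesis.Theorems.BarrierLever.ChowFactor

open Finset MvPolynomial

noncomputable section

variable {h : ℕ}

/-! ## 1. Affine polynomials -/

/-- An exponent of degree `≤ 1` is `0` or a unit vector. -/
theorem finsupp_eq_zero_or_single_of_degree_le_one {σ : Type*} (m : σ →₀ ℕ)
    (hm : (m.sum fun _ e => e) ≤ 1) : m = 0 ∨ ∃ v, m = Finsupp.single v 1 := by
  classical
  by_cases h0 : m = 0
  · exact Or.inl h0
  · right
    obtain ⟨v, hv⟩ := Finsupp.ne_iff.mp h0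
    simp only [Finsupp.coe_zero, Pi.zero_apply] at hv
    have hvs : v ∈ m.support := Finsupp.mem_support_iff.mpr hv
    have hle : m v ≤ m.sum fun _ e => e := by
      unfold Finsupp.sum
      exact Finset.single_le_sum (fun _ _ => Nat.zero_le _) hvs
    refine ⟨v, ?_⟩
    ext v'
    by_cases hvv : v' = v
    · subst hvv
      rw [Finsupp.single_eq_same]
      omega
    · rw [Finsupp.single_eq_of_ne hvv]
      by_contra hne
      have hvs' : v' ∈ m.support := Finsupp.mem_support_iff.mpr hne
      have h2 : m v + m v' ≤ m.sum fun _ e => e := by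
        unfold Finsupp.sum
        exact Finset.add_le_sum (fun _ _ => Nat.zero_le _) hvs hvs' (Ne.symm hvv)
      omega

/-- **A polynomial of total degree `≤ 1` is affine**: `ℓ = C (coeff 0 ℓ) + Σ_v C (coeff e_v ℓ) · X v`. -/
theorem eq_affine_of_totalDegree_le_one {R : Type*} [CommSemiring R] {n : ℕ}
    (ℓ : MvPolynomial (Fin n) R) (hℓ : ℓ.totalDegree ≤ 1) :
    ℓ = C (coeff 0 ℓ) + ∑ v : Fin n, C (coeff (Finsupp.single v 1) ℓ) * X v := by
  classical
  ext m
  rw [coeff_add, coeff_C, coeff_sum]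
  simp_rw [coeff_C_mul, coeff_X]
  by_cases hdeg : (m.sum fun _ e => e) ≤ 1
  · rcases finsupp_eq_zero_or_single_of_degree_le_one m hdeg with rfl | ⟨v, rfl⟩
    · rw [if_pos rfl]
      have hz : ∀ v : Fin n, coeff (Finsupp.single v 1) ℓ *
          (if Finsupp.single v 1 = (0 : Fin n →₀ ℕ) then (1 : R) else 0) = 0 := by
        intro v
        rw [if_neg (Finsupp.single_ne_zero.mpr one_ne_zero), mul_zero]
      rw [Finset.sum_eq_zero fun v _ => hz v, add_zero]
    · rw [if_neg (Ne.symm (Finsupp.single_ne_zero.mpr one_ne_zero))]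
      rw [Finset.sum_eq_single v]
      · rw [if_pos rfl, mul_one, zero_add]
      · intro v' _ hv'
        rw [if_neg, mul_zero]
        intro he
        exact hv' (Finsupp.single_left_injective one_ne_zero he)
      · intro hv
        exact absurd (Finset.mem_univ v) hv
  · -- degree ≥ 2: both sides vanish
    have hm0 : m ≠ 0 := by
      rintro rfl
      simp at hdeg
    have hms : ∀ v : Fin n, Finsupp.single v 1 ≠ m := by
      intro v he
      apply hdeg
      rw [← he, Finsupp.sum_single_index rfl]
    have hc : coeff m ℓ = 0 := by
      by_contra hne
      exact hdeg ((le_totalDegree (mem_support_iff.mpr hne)).trans hℓ)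
    rw [hc, if_neg (fun e => hm0 e.symm)]
    rw [Finset.sum_eq_zero fun v _ => by rw [if_neg (hms v), mul_zero], add_zero]

/-- An affine combination `C c + Σ_v C c_v · X v` has total degree `≤ 1`. -/
theorem totalDegree_affine_le {R : Type*} [CommSemiring R] {n : ℕ} (c : R) (cv : Fin n → R) :
    (C c + ∑ v : Fin n, C (cv v) * X v : MvPolynomial (Fin n) R).totalDegree ≤ 1 := by
  refine (totalDegree_add _ _).trans (max_le ?_ ?_)
  · rw [totalDegree_C]
    exact Nat.zero_le _
  · refine (totalDegree_finsetSum _ _).trans (Finset.sup_le fun v _ => ?_)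
    refine (totalDegree_mul _ _).trans ?_
    rw [totalDegree_C, zero_add]
    refine (totalDegree_monomial_le _ _).trans ?_
    rw [Finsupp.sum_single_index rfl]
    exact le_rfl

/-! ## 2. The generic product of `h + h` affine forms -/

/-- **Specialising the generic product**: evaluating the indeterminate coefficients at `θ` gives
the concrete product `∏_k (C θ(k,∅) + Σ_v C θ(k,v) · X v)`. -/
theorem map_eval_genericChow (θ : Fin (h + h) × Option (Fin (h + h)) → ℂ) :
    MvPolynomial.map (eval θ)
        (∏ k : Fin (h + h), (C (X (k, none)) + ∑ v : Fin (h + h), C (X (k, some v)) * X v :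
          MvPolynomial (Fin (h + h)) (MvPolynomial (Fin (h + h) × Option (Fin (h + h))) ℂ))) =
      ∏ k : Fin (h + h), (C (θ (k, none)) + ∑ v : Fin (h + h), C (θ (k, some v)) * X v) := by
  rw [map_prod]
  refine Finset.prod_congr rfl fun k _ => ?_
  rw [map_add, map_C, map_sum, eval_X]
  refine congrArg _ (Finset.sum_congr rfl fun v _ => ?_)
  rw [map_mul, map_C, map_X, eval_X]

/-- **The partition minor of the generic product, evaluated, is the partition minor of the
concrete product.** -/
theorem eval_det_coeff_genericChow (θ : Fin (h + h) × Option (Fin (h + h)) → ℂ) {r : ℕ}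
    (u w : Fin r → Finset (Fin h)) :
    eval θ (Matrix.of fun i j : Fin r => coeff
        (∑ a ∈ u i, Finsupp.single (Fin.castAdd h a) 1 + ∑ c ∈ w j, Finsupp.single (Fin.natAdd h c) 1)
        (∏ k : Fin (h + h), (C (X (k, none)) + ∑ v : Fin (h + h), C (X (k, some v)) * X v :
          MvPolynomial (Fin (h + h)) (MvPolynomial (Fin (h + h) × Option (Fin (h + h))) ℂ)))).det =
      (Matrix.of fun i j : Fin r => coeff
        (∑ a ∈ u i, Finsupp.single (Fin.castAdd h a) 1 + ∑ c ∈ w j, Finsupp.single (Fin.natAdd h c) 1)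
        (∏ k : Fin (h + h), (C (θ (k, none)) + ∑ v : Fin (h + h), C (θ (k, some v)) * X v :
          MvPolynomial (Fin (h + h)) ℂ))).det := by
  rw [RingHom.map_det]
  congr 1
  ext i j
  rw [RingHom.mapMatrix_apply, Matrix.map_apply, Matrix.of_apply, Matrix.of_apply,
    ← map_eval_genericChow θ, coeff_map]

/-- **A hit layout makes the generic minor nonzero.** -/
theorem genericChow_det_ne_zero_of_hit {r : ℕ} (u w : Fin r → Finset (Fin h))
    (hhit : ∃ ℓ : Fin (h + h) → MvPolynomial (Fin (h + h)) ℂ, (∀ k, (ℓ k).totalDegree ≤ 1) ∧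
      (Matrix.of fun i j : Fin r => coeff
        (∑ a ∈ u i, Finsupp.single (Fin.castAdd h a) 1 + ∑ c ∈ w j, Finsupp.single (Fin.natAdd h c) 1)
        (∏ k, ℓ k)).det ≠ 0) :
    (Matrix.of fun i j : Fin r => coeff
        (∑ a ∈ u i, Finsupp.single (Fin.castAdd h a) 1 + ∑ c ∈ w j, Finsupp.single (Fin.natAdd h c) 1)
        (∏ k : Fin (h + h), (C (X (k, none)) + ∑ v : Fin (h + h), C (X (k, some v)) * X v :
          MvPolynomial (Fin (h + h)) (MvPolynomial (Fin (h + h) × Option (Fin (h + h))) ℂ)))).det ≠ 0 := by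
  obtain ⟨ℓ, hdeg, hdet⟩ := hhit
  -- the coefficients of `ℓ`
  set θ : Fin (h + h) × Option (Fin (h + h)) → ℂ := fun p =>
    Option.elim p.2 (coeff 0 (ℓ p.1)) (fun v => coeff (Finsupp.single v 1) (ℓ p.1)) with hθ
  have hℓ : (∏ k : Fin (h + h), (C (θ (k, none)) + ∑ v : Fin (h + h), C (θ (k, some v)) * X v :
      MvPolynomial (Fin (h + h)) ℂ)) = ∏ k, ℓ k := by
    refine Finset.prod_congr rfl fun k _ => ?_
    rw [hθ]
    dsimp only [Option.elim]
    exact (eq_affine_of_totalDegree_le_one (ℓ k) (hdeg k)).symm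
  intro hzero
  apply hdet
  rw [← hℓ, ← eval_det_coeff_genericChow θ u w, hzero, map_zero]

/-! ## 3. One witness for finitely many layouts -/

/-- **Finitely many layouts, each hit by some product of `h + h` affine forms, are hit by ONE
product** (the product of the generic minors is a nonzero polynomial in the coefficients, and `ℂ`
is infinite). -/
theorem exists_common_chow_witness {ι : Type*} (S : Finset ι) (r : ι → ℕ)
    (u w : (i : ι) → Fin (r i) → Finset (Fin h))
    (hhit : ∀ i ∈ S, ∃ ℓ : Fin (h + h) → MvPolynomial (Fin (h + h)) ℂ,
      (∀ k, (ℓ k).totalDegree ≤ 1) ∧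
      (Matrix.of fun a b : Fin (r i) => coeff
        (∑ x ∈ u i a, Finsupp.single (Fin.castAdd h x) 1 +
          ∑ c ∈ w i b, Finsupp.single (Fin.natAdd h c) 1) (∏ k, ℓ k)).det ≠ 0) :
    ∃ ℓ : Fin (h + h) → MvPolynomial (Fin (h + h)) ℂ, (∀ k, (ℓ k).totalDegree ≤ 1) ∧
      ∀ i ∈ S, (Matrix.of fun a b : Fin (r i) => coeff
        (∑ x ∈ u i a, Finsupp.single (Fin.castAdd h x) 1 +
          ∑ c ∈ w i b, Finsupp.single (Fin.natAdd h c) 1) (∏ k, ℓ k)).det ≠ 0 := by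
  classical
  -- the generic minors and their product
  set P : ι → MvPolynomial (Fin (h + h) × Option (Fin (h + h))) ℂ := fun i =>
    (Matrix.of fun a b : Fin (r i) => coeff
        (∑ x ∈ u i a, Finsupp.single (Fin.castAdd h x) 1 +
          ∑ c ∈ w i b, Finsupp.single (Fin.natAdd h c) 1)
        (∏ k : Fin (h + h), (C (X (k, none)) + ∑ v : Fin (h + h), C (X (k, some v)) * X v :
          MvPolynomial (Fin (h + h)) (MvPolynomial (Fin (h + h) × Option (Fin (h + h))) ℂ)))).det
    with hP
  have hPne : ∀ i ∈ S, P i ≠ 0 := fun i hi => genericChow_det_ne_zero_of_hit (u i) (w i) (hhit i hi)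
  have hprod : ∏ i ∈ S, P i ≠ 0 := Finset.prod_ne_zero_iff.mpr hPne
  -- a non-root of the product
  obtain ⟨θ, hθ⟩ : ∃ θ : Fin (h + h) × Option (Fin (h + h)) → ℂ, eval θ (∏ i ∈ S, P i) ≠ 0 := by
    by_contra hall
    push Not at hall
    exact hprod (MvPolynomial.funext fun θ => by rw [hall θ, map_zero])
  rw [map_prod] at hθ
  refine ⟨fun k => C (θ (k, none)) + ∑ v : Fin (h + h), C (θ (k, some v)) * X v,
    fun k => totalDegree_affine_le _ _, fun i hi => ?_⟩
  have hi' := (Finset.prod_ne_zero_iff.mp hθ) i hi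
  rw [hP] at hi'
  dsimp only at hi'
  rw [eval_det_coeff_genericChow θ (u i) (w i)] at hi'
  exact hi'

end

end Summit.ValiantsHypothesis.ValiantsHypothesis.Theorems.BarrierLever.ChowFactor
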